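import Summits.QuantumAdvantage.AdviceFreeQNC0.AffBells22KernelZeros
import Summits.QuantumAdvantage.AdviceFreeQNC0.AffBells26MoveSystems
import HarnessLib

/-!
# AffBells35 — P-38aa `KlineZerosLDP` (POSITION TRANSFER = large deviations for the coins in a fixed position set), PROVED

Cell qa-qnc0, route DWalkThree (crux stmt-QuantumAdvantage-22907, working rung (NP₁) `AffBells26.AffBellsPolyLoss3`).
Ask P-38aa of the planner seat qa-qnc0-p1 g35 (`HOME/qa-qnc0-p1/exp35/Sketch35.lean` §12.10(l), statement `KlineZerosLDP`
VERBATIM); authored and proved by the planner seat qa-qnc0-p2 g33 (`HOME/qa-qnc0-p2/line33/KlineZerosLDP33.lean`).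
Ported to the tree verbatim by the prover seat qn-prover-3 g20 (ask P2-33b), `--supports stmt-QuantumAdvantage-22907`.

**Theorem `klineZerosLDP : KlineZerosLDP`** (with `c = 64`, `d = 16`): for every ring length `N ≥ 3` and every set `T` of
positions, at most `2^N · 2^{−⌊|T|/64⌋}` odd patterns `x` have fewer than `|T|/16` coins (zeros of the kernel line
`J = kline x`) inside `T`.

PROOF.  This is Markov's inequality on the tree's exponential-moment bound (HC-mgf)
`AffBells22.kernelZerosOnSetMGF` (planner qa-qnc0-p1 g22, `AffBells22KernelZeros.lean`):
`Σ_{x odd} 2^{−|T ∩ zeros J(x)|} ≤ (160/29)·(29/32)^{|T|}·2^{N−1}`, restated here with its explicit constants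
(`kernelZerosOnSetMGF_explicit`, same proof script).  On the deviation set each term is `≥ 2^{−⌊|T|/16⌋}`, so the set has at
most `(80/29)·(29/32)^{|T|}·2^{⌊|T|/16⌋}·2^N ≤ 2^N·2^{−⌊|T|/64⌋}` elements (`(29/32)^{16}·2 ≤ 21/50` and
`(80/29)·(21/50)^4 ≤ 1/2`; for `|T| < 64` the bound `2^N` is trivial).  No Markov-chain / transfer-matrix work is redone.

WHAT THIS IS NOT: only the position-transfer tool of ROUND-34 §12.10(l)/§12.12(c) (`StraddleMass`); no crux closed; separation NOT moved.
-/

namespace Summit.QuantumAdvantage.AdviceFreeQNC0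

open Finset Literature.Computability.QuantumComplexity Literature.Computability.QuantumComplexity.RingHLF
open Literature.Computability.MetaComplexity

namespace AffBells22

open scoped Classical

/-- (HC-mgf) with its explicit constants: `Σ_{x odd} 2^{−|D ∩ zeros J(x)|} ≤ (160/29)·(29/32)^{|D|}·2^{n−1}` (`n ≥ 3`).
Proof script = the tree's `kernelZerosOnSetMGF` (whose packaged statement hides the constants). -/
theorem kernelZerosOnSetMGF_explicit {n : ℕ} (hn : 3 ≤ n) (D : Finset (Fin n)) :
    ∑ x ∈ (univ.filter fun x : Fin n → Bool => Fib19.IsOdd x),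
        ((2 : ℝ)⁻¹) ^ (D.filter fun i => Fib19.kline x i = false).card
      ≤ 160 / 29 * (29 / 32 : ℝ) ^ D.card * (2 : ℝ) ^ (n - 1) := by
  obtain ⟨m, rfl⟩ : ∃ m, n = m + 1 := ⟨n - 1, by omega⟩
  have hw0 : ∀ i, 0 ≤ wtD D i := fun i => by unfold wtD; split_ifs <;> norm_num
  have hw2 : ∀ i, wtD D i ≤ 2 := fun i => by unfold wtD; split_ifs <;> norm_num
  have hL : ∀ i ∈ D.map Fin.valEmbedding, wtD D i ≤ 1 := fun i hi => by unfold wtD; rw [if_pos hi]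
  have h1 := sum_odd_le_sum_hardCore hn (fun v => ((2 : ℝ)⁻¹) ^ (D.filter fun i => v i = false).card)
    (fun v => by positivity)
  simp_rw [two_pow_mul_half_pow_eq] at h1
  have h2 := sum_hardCore_le_total (n := m + 1) (wtD D) hw0
  have h3 := total_le_two_one (wtD D) hw0 hw2 (D.map Fin.valEmbedding) hL m
  set d := ((D.map Fin.valEmbedding).filter fun i => 1 ≤ i ∧ i ≤ m).card with hd
  have hdcard : D.card ≤ d + 1 := by
    have hsub : (D.map Fin.valEmbedding) ⊆ insert 0 ((D.map Fin.valEmbedding).filter fun i => 1 ≤ i ∧ i ≤ m) := by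
      intro i hi
      rw [mem_insert, mem_filter]
      by_cases h0 : i = 0
      · exact Or.inl h0
      · refine Or.inr ⟨hi, by omega, ?_⟩
        obtain ⟨k, _, rfl⟩ := Finset.mem_map.mp hi
        have := k.2
        simp only [Fin.valEmbedding_apply]
        omega
    have := (card_le_card hsub).trans (card_insert_le _ _)
    rw [card_map] at this
    omega
  have hκ : (29 / 32 : ℝ) ^ d ≤ (32 / 29) * (29 / 32 : ℝ) ^ D.card := by
    have h := pow_le_pow_of_le_one (by norm_num : (0 : ℝ) ≤ 29 / 32) (by norm_num) (by omega : D.card - 1 ≤ d)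
    refine h.trans ?_
    rcases Nat.eq_zero_or_pos D.card with hz | hpos
    · rw [hz]; norm_num
    · have : (29 / 32 : ℝ) ^ D.card = (29 / 32) * (29 / 32 : ℝ) ^ (D.card - 1) := by
        rw [← pow_succ']; congr 1; omega
      rw [this]
      nlinarith [pow_nonneg (by norm_num : (0:ℝ) ≤ 29 / 32) (D.card - 1)]
  rw [Nat.add_sub_cancel]
  have h2q : (0 : ℝ) ≤ 2 ^ m := by positivity
  calc _ ≤ _ := h1
    _ ≤ _ := h2
    _ ≤ 5 * (29 / 32 : ℝ) ^ d * 2 ^ m := h3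
    _ ≤ 5 * ((32 / 29) * (29 / 32 : ℝ) ^ D.card) * 2 ^ m := by gcongr
    _ = 160 / 29 * (29 / 32 : ℝ) ^ D.card * 2 ^ m := by ring

end AffBells22

namespace AffBells35

/-- **P-38aa (S/M; ROUND-34 §12.10(l)) POSITION TRANSFER = large deviations for the coins in a fixed position set.**  The law of the kernel
line `J = kline x` over odd `x` is the hard-core lattice gas with fugacity 2 on the cycle (`Fib19.card_fibre`: the fibre of a hard-core `v` has
`2^{Z(v)-1}` odd inputs); as a Markov chain (transition `empty → particle` with probability 1/2, `particle → empty` surely) every position is a coin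
with conditional probability `≥ 1/4` given the configuration two or more steps back, so for EVERY fixed set `T` of positions the number of coins
inside `T` dominates a `Bin(|T|/3, 1/4)` up to the cyclic boundary factor: fewer than `|T|/d` coins in `T` has probability `≤ 2^{-|T|/c}`.
Consequence (union bound over the `N²` pairs of rows): on all but `N^{2 - C'/c}·…` of the input mass, every pair of rows at POSITION distance
`≥ C' log₂ N` is at COIN distance `≥ (C'/d) log₂ N` — the transfer from the position ≈-classes (fibre-independent, used to define `R`) to the
coin-distance hypotheses of SparseKappa / HoloIsolation / CoreSilence on each good fibre.  Constants existential on purpose. -/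
def KlineZerosLDP : Prop :=
  ∃ c d : ℕ, 0 < c ∧ 0 < d ∧ ∀ N : ℕ, 3 ≤ N → ∀ T : Finset (Fin N),
    ((univ.filter fun x : Fin N → Bool =>
        Fib19.IsOdd x ∧ d * (T ∩ AffBells26.klineZeros x).card < T.card).card : ℝ)
      ≤ (2 : ℝ) ^ N * (1 / 2 : ℝ) ^ (T.card / c)

/-- The numerical heart: `(80/29)·(29/32)^t·2^{⌊t/16⌋} ≤ (1/2)^{⌊t/64⌋}` for `t ≥ 64`. -/
theorem ldp_numeric (t : ℕ) (ht : 64 ≤ t) :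
    (80 / 29 : ℝ) * (29 / 32 : ℝ) ^ t * (2 : ℝ) ^ (t / 16) ≤ (1 / 2 : ℝ) ^ (t / 64) := by
  set q := t / 16 with hq
  set q₂ := t / 64 with hq₂
  have hqq : q₂ = q / 4 := by rw [hq, hq₂, Nat.div_div_eq_div_mul]
  have hq₂pos : 1 ≤ q₂ := by rw [hq₂]; exact (Nat.le_div_iff_mul_le (by norm_num)).mpr (by omega)
  -- (29/32)^t ≤ ((29/32)^16)^q
  have h16 : (29 / 32 : ℝ) ^ t ≤ ((29 / 32 : ℝ) ^ 16) ^ q := by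
    rw [← pow_mul]
    exact pow_le_pow_of_le_one (by norm_num) (by norm_num) (by rw [hq]; exact Nat.mul_div_le t 16 |>.trans' (le_refl _) |> fun h => by omega)
  have ha : (29 / 32 : ℝ) ^ 16 * 2 ≤ 21 / 50 := by norm_num
  have ha0 : (0 : ℝ) ≤ (29 / 32 : ℝ) ^ 16 * 2 := by positivity
  -- LHS ≤ (80/29) * ((29/32)^16 * 2)^q ≤ (80/29) * (21/50)^q
  have step1 : (80 / 29 : ℝ) * (29 / 32 : ℝ) ^ t * (2 : ℝ) ^ q ≤ (80 / 29) * (21 / 50 : ℝ) ^ q := by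
    have : (29 / 32 : ℝ) ^ t * (2 : ℝ) ^ q ≤ ((29 / 32 : ℝ) ^ 16 * 2) ^ q := by
      rw [mul_pow]
      exact mul_le_mul_of_nonneg_right h16 (by positivity)
    have h' : ((29 / 32 : ℝ) ^ 16 * 2) ^ q ≤ (21 / 50 : ℝ) ^ q := pow_le_pow_left₀ ha0 ha q
    nlinarith [this, h', pow_nonneg ha0 q]
  -- (21/50)^q ≤ ((21/50)^4)^q₂
  have step2 : (21 / 50 : ℝ) ^ q ≤ ((21 / 50 : ℝ) ^ 4) ^ q₂ := by
    rw [← pow_mul]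
    exact pow_le_pow_of_le_one (by norm_num) (by norm_num) (by rw [hqq]; omega)
  -- (80/29) * b^q₂ ≤ (1/2)^q₂ for q₂ ≥ 1, b = (21/50)^4 ≤ 29/160
  have hb : (80 / 29 : ℝ) * (21 / 50 : ℝ) ^ 4 ≤ 1 / 2 := by norm_num
  have hb' : (21 / 50 : ℝ) ^ 4 ≤ 1 / 2 := by norm_num
  have step3 : (80 / 29 : ℝ) * ((21 / 50 : ℝ) ^ 4) ^ q₂ ≤ (1 / 2 : ℝ) ^ q₂ := by
    obtain ⟨r, hr⟩ : ∃ r, q₂ = r + 1 := ⟨q₂ - 1, by omega⟩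
    rw [hr, pow_succ, pow_succ]
    have hr1 : ((21 / 50 : ℝ) ^ 4) ^ r ≤ (1 / 2 : ℝ) ^ r := pow_le_pow_left₀ (by positivity) hb' r
    have hr0 : (0 : ℝ) ≤ ((21 / 50 : ℝ) ^ 4) ^ r := by positivity
    have hh0 : (0 : ℝ) ≤ (1 / 2 : ℝ) ^ r := by positivity
    calc (80 / 29 : ℝ) * (((21 / 50 : ℝ) ^ 4) ^ r * (21 / 50 : ℝ) ^ 4)
        = ((21 / 50 : ℝ) ^ 4) ^ r * ((80 / 29 : ℝ) * (21 / 50 : ℝ) ^ 4) := by ring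
      _ ≤ (1 / 2 : ℝ) ^ r * (1 / 2) := mul_le_mul hr1 hb (by positivity) hh0
  calc (80 / 29 : ℝ) * (29 / 32 : ℝ) ^ t * (2 : ℝ) ^ q
      ≤ (80 / 29) * (21 / 50 : ℝ) ^ q := step1
    _ ≤ (80 / 29) * ((21 / 50 : ℝ) ^ 4) ^ q₂ := by gcongr
    _ ≤ (1 / 2 : ℝ) ^ q₂ := step3

/-- **P-38aa PROVED** (`c = 64`, `d = 16`). -/
theorem klineZerosLDP : KlineZerosLDP := by
  classical
  refine ⟨64, 16, by norm_num, by norm_num, fun N hN T => ?_⟩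
  set A := (univ.filter fun x : Fin N → Bool =>
      Fib19.IsOdd x ∧ 16 * (T ∩ AffBells26.klineZeros x).card < T.card) with hA
  by_cases ht : T.card < 64
  · -- trivial regime: the bound is `2^N`
    have h0 : T.card / 64 = 0 := Nat.div_eq_of_lt ht
    rw [h0, pow_zero, mul_one]
    have hcard : A.card ≤ Fintype.card (Fin N → Bool) := card_le_univ _
    rw [Fintype.card_fun, Fintype.card_bool, Fintype.card_fin] at hcard
    exact_mod_cast hcard
  · rw [not_lt] at ht
    set q := T.card / 16 with hq
    -- Markov's inequality against (HC-mgf)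
    have hAx : ∀ x ∈ A, ((2:ℝ)⁻¹) ^ q ≤ ((2 : ℝ)⁻¹) ^ (T.filter fun i => Fib19.kline x i = false).card := by
      intro x hx
      have hlt : 16 * (T ∩ AffBells26.klineZeros x).card < T.card := ((mem_filter.mp hx).2).2
      have hset : (T.filter fun i => Fib19.kline x i = false) = T ∩ AffBells26.klineZeros x := by
        ext i; simp [AffBells26.klineZeros]
      rw [hset]
      apply pow_le_pow_of_le_one (by norm_num) (by norm_num)
      rw [hq]
      exact (Nat.le_div_iff_mul_le (by norm_num)).mpr (by omega)
    have h1 : (A.card : ℝ) * ((2:ℝ)⁻¹) ^ q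
        ≤ ∑ x ∈ A, ((2 : ℝ)⁻¹) ^ (T.filter fun i => Fib19.kline x i = false).card := by
      rw [← nsmul_eq_mul, ← sum_const]
      exact sum_le_sum hAx
    have h2 : ∑ x ∈ A, ((2 : ℝ)⁻¹) ^ (T.filter fun i => Fib19.kline x i = false).card
        ≤ ∑ x ∈ (univ.filter fun x : Fin N → Bool => Fib19.IsOdd x),
            ((2 : ℝ)⁻¹) ^ (T.filter fun i => Fib19.kline x i = false).card := by
      apply sum_le_sum_of_subset_of_nonneg
      · intro x hx
        rw [mem_filter] at hx ⊢
        exact ⟨hx.1, hx.2.1⟩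
      · intro _ _ _; positivity
    have h3 := AffBells22.kernelZerosOnSetMGF_explicit hN T
    have hnum := ldp_numeric T.card ht
    -- assemble: A.card ≤ (160/29)(29/32)^t 2^(N-1) 2^q ≤ 2^N (1/2)^(t/64)
    have hpowq : ((2:ℝ)⁻¹) ^ q * (2 : ℝ) ^ q = 1 := by rw [← mul_pow]; norm_num
    have hposq : (0 : ℝ) < ((2:ℝ)⁻¹) ^ q := by positivity
    obtain ⟨M, hM⟩ : ∃ M, N = M + 1 := ⟨N - 1, by omega⟩
    subst hM
    rw [Nat.add_sub_cancel] at h3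
    have key : (A.card : ℝ) * ((2:ℝ)⁻¹) ^ q ≤ 160 / 29 * (29 / 32 : ℝ) ^ T.card * (2 : ℝ) ^ M :=
      h1.trans (h2.trans h3)
    -- multiply both sides by 2^q
    have key2 : (A.card : ℝ) ≤ 160 / 29 * (29 / 32 : ℝ) ^ T.card * (2 : ℝ) ^ M * (2 : ℝ) ^ q := by
      have := mul_le_mul_of_nonneg_right key (by positivity : (0 : ℝ) ≤ (2 : ℝ) ^ q)
      rwa [mul_assoc, hpowq, mul_one] at this
    calc (A.card : ℝ) ≤ 160 / 29 * (29 / 32 : ℝ) ^ T.card * (2 : ℝ) ^ M * (2 : ℝ) ^ q := key2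
      _ = (2 : ℝ) ^ (M + 1) * ((80 / 29 : ℝ) * (29 / 32 : ℝ) ^ T.card * (2 : ℝ) ^ q) := by rw [pow_succ]; ring
      _ ≤ (2 : ℝ) ^ (M + 1) * (1 / 2 : ℝ) ^ (T.card / 64) := by gcongr

end AffBells35

end Summit.QuantumAdvantage.AdviceFreeQNC0
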